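import Summits.ResolutionOfSingularities.ResolutionOfSingularities.Theorems.FloorCutClasses
import Summits.ResolutionOfSingularities.ResolutionOfSingularities.Theorems.JumpCutPlateaux
import Summits.ResolutionOfSingularities.ResolutionOfSingularities.Theorems.MaxContactCutItineraryCut
import Summits.ResolutionOfSingularities.ResolutionOfSingularities.Theorems.MaxContactCutExponentLadder
import Summits.ResolutionOfSingularities.ResolutionOfSingularities.Theorems.NoJump
import HarnessLib

/-!
# MaxContactCutFloorCut — §4, §6, §6b of the decomp-res node «FloorCut» (lens-3 g14 rev 1, sha256
a6cd0c219cc20b64; LEDGER line 115 CLEARED)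
BY NAME on the host route `MaxContactCut`

Tree file 3/3: §4 THE EXACT CUT of the parent residual `JumpCut.NoRecurrentSubcriticalPlateauxDeep ⟺
NoFloorEdgePlateauxDeep ∧
NoHighPlateauxDeep` and necessity from the deep class; §6 WIRING — the ONE certified EQUIV and the asides 31870 /
31770 BY NAME;
§6b DISCHARGE BY NAME through the tree's `Theorems/NoJump` (`ShadeNeverIncreases` := `NoJump.shade_succ_le_shade`, the jump half
`NoJump.noRecurrentJumpWalksDeep_holds`) and `ProximityCut.noOriginTails_holds` — VERBATIM from the lens file; the
lens's §7 root
`closes (8 hyps)` is literally the tree's `MaxContactCutExponentLadder.closes` and is cited, not restated (gate dedup).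
(Sources: Hauser2010 §G; CossartJannsenSaito2020 Thm. 2.14; CossartPiltant2019.)
-/

open MvPolynomial Finset
open Literature.AlgebraicGeometry.Resolution
open Literature.AlgebraicGeometry.Resolution.Hauser2010
open Literature.AlgebraicGeometry.Resolution.PointBlowup
open Summit.ResolutionOfSingularities.ResolutionOfSingularities.Theorems.TightDefectClasses
open Summit.ResolutionOfSingularities.ResolutionOfSingularities.Theorems.TightDefectStrongWalks
open Summit.ResolutionOfSingularities.ResolutionOfSingularities.Theorems.ItineraryCutClasses
open Summit.ResolutionOfSingularities.ResolutionOfSingularities.Theorems.BoundaryLedger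
open Summit.ResolutionOfSingularities.ResolutionOfSingularities.Theorems.NoJump
open Summit.ResolutionOfSingularities.ResolutionOfSingularities.Theorems.JumpCut (NoRecurrentSubcriticalPlateauxDeep)
open Summit.ResolutionOfSingularities.ResolutionOfSingularities.Theorems.ProximityCut (NoOriginTails noOriginTails_holds)

namespace Summit.ResolutionOfSingularities.ResolutionOfSingularities.Theorems.FloorCut

/-! ## §4 THE EXACT CUT of the parent by the order floor, and necessity -/

section Cut

/-- The floor half is WEAKER than the parent (by letter: drop the floor data). [folklore] -/
theorem floorEdge_of_recSubcritical (h : NoRecurrentSubcriticalPlateauxDeep) : NoFloorEdgePlateauxDeep :=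
  fun p hp e he K _ _ _ _ s₀ hs W N s _ h1 hsq hfl htr =>
    h p hp e he K s₀ hs W N s h1 hsq (fun t ht => (hfl t ht).1) htr

/-- The high half is WEAKER than the parent (by letter). [folklore] -/
theorem high_of_recSubcritical (h : NoRecurrentSubcriticalPlateauxDeep) : NoHighPlateauxDeep :=
  fun p hp e he K _ _ _ _ s₀ hs W N s h1 hsq hhi htr =>
    h p hp e he K s₀ hs W N s h1 hsq (fun t ht => (hhi t ht).1) htr

/-- **The parent from the two halves (PROVED; kernel = FLOOR ABSORPTION).**  On a translation-recurrent subcritical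
plateau either some time `t₀ ≥ N` is a floor time — then §2 freezes the boundary to one hugged edge and the floor
half applies from `t₀` — or the order stays `> q` from `N` on and the high half applies. [folklore] -/
theorem recSubcritical_of_floor_high (hF : NoFloorEdgePlateauxDeep) (hH : NoHighPlateauxDeep) :
    NoRecurrentSubcriticalPlateauxDeep := by
  intro p hp e he K _ _ _ _ s₀ hs W N s h1 hsq hplat htr
  classical
  by_cases hfloor : ∃ t₀, N ≤ t₀ ∧ ordZero (W.st t₀).F = ((p ^ e : ℕ) : ℕ∞)
  · obtain ⟨t₀, ht₀, ho⟩ := hfloor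
    have htr' : ∀ M : ℕ, ∃ t, M ≤ t ∧ W.b t ≠ 0 := htr
    obtain ⟨i, hi⟩ := floor_single hs W hsq hplat ht₀ ho htr'
    have hpos : 0 < (W.st t₀).r i := by
      rw [hi t₀ le_rfl, Finsupp.single_eq_same]
      omega
    refine hF p hp e he K s₀ hs W t₀ s i h1 hsq (fun t ht => ?_) htr
    obtain ⟨hj, hb⟩ := floor_hugs hs W hplat ht₀ ho hpos t ht
    exact ⟨hplat t (ht₀.trans ht), (floor_absorbing hs W hplat ht₀ ho t ht).1, hi t ht, hj, hb⟩
  · push Not at hfloor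
    refine hH p hp e he K s₀ hs W N s h1 hsq (fun t ht => ⟨hplat t ht, ?_⟩) htr
    obtain ⟨o, ho, hqo⟩ := walk_nat hs W t
    have hne : o ≠ p ^ e := by
      intro hoq
      exact hfloor t ht (by rw [ho, hoq])
    rw [ho]
    exact_mod_cast lt_of_le_of_ne hqo (Ne.symm hne)

/-- **THE EXACT CUT OF THE PARENT (PROVED):
`NoRecurrentSubcriticalPlateauxDeep ⟺ NoFloorEdgePlateauxDeep ∧ NoHighPlateauxDeep`.** [folklore] -/
theorem recSubcritical_iff_floor_high :
    NoRecurrentSubcriticalPlateauxDeep ↔ NoFloorEdgePlateauxDeep ∧ NoHighPlateauxDeep :=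
  ⟨fun h => ⟨floorEdge_of_recSubcritical h, high_of_recSubcritical h⟩,
    fun h => recSubcritical_of_floor_high h.1 h.2⟩

/-- The floor cell is WEAKER than the blocker's class BY LETTER. [folklore] -/
theorem floorTails_of_deep (h : DefectWalksTerminateDeep) : NoFloorTailsDeep :=
  fun p hp e he K _ _ _ _ s₀ hs W hpos _ _ => h p hp e he K s₀ hs W hpos

/-- **The tree's bare critical cell from the floor cell (by letter)** — one port text books both. [folklore] -/
theorem bare_of_floorTails (hT : NoFloorTailsDeep) : NoBareTailsDeep :=
  fun p hp e he K _ _ _ _ s₀ hs W hpos N hB => hT p hp e he K s₀ hs W hpos N fun t ht => (hB t ht).2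

/-- Under the no-jump law a walk that reaches a plateau of positive height had positive shade all along. [folklore] -/
theorem hpos_of_plateau (hA : ShadeNeverIncreases) {p e : ℕ} (hp : p.Prime) (he : 1 ≤ e) {K : Type} [Field K]
    [CharP K p] [PerfectField K] [DecidableEq K] {s₀ : State (Fin 3) K} (hs : IsRoot (p ^ e) s₀)
    (W : ForcedWalk (p ^ e) s₀) {N s : ℕ} (hplat : ∀ t, N ≤ t → (W.st t).shade = (s : ℕ∞)) (h1 : 1 ≤ s) :
    ∀ i, 1 ≤ (W.st i).shade := by
  have hanti : ∀ i t, i ≤ t → (W.st t).shade ≤ (W.st i).shade := by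
    intro i t hit
    induction t, hit using Nat.le_induction with
    | base => exact le_rfl
    | succ t _ ih => exact (hA p hp e he K s₀ hs W t).trans ih
  intro i
  rcases le_or_gt i N with hi | hi
  · have h := hanti i N hi
    rw [hplat N le_rfl] at h
    exact le_trans (by exact_mod_cast h1) h
  · rw [hplat i hi.le]
    exact_mod_cast h1

/-- **The floor half of the parent from the floor cell** (via the PROVED no-jump law, which supplies positive shade
before the plateau). [folklore] -/
theorem floorEdge_of_floorTails (hA : ShadeNeverIncreases) (hT : NoFloorTailsDeep) : NoFloorEdgePlateauxDeep :=
  fun p hp e he K _ _ _ _ s₀ hs W N _ _ h1 _ hfl _ =>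
    hT p hp e he K s₀ hs W (hpos_of_plateau hA hp (one_le_two.trans he) hs W (fun t ht => (hfl t ht).1) h1) N
      fun t ht => (hfl t ht).2.1

/-- Necessity of the parent from the blocker's class (modulo the PROVED no-jump law; = g13 `recSubcritical_of_deep`).
[folklore] -/
theorem recSubcritical_of_deep (hA : ShadeNeverIncreases) (h : DefectWalksTerminateDeep) :
    NoRecurrentSubcriticalPlateauxDeep :=
  fun p hp e he K _ _ _ _ s₀ hs W _ _ h1 _ hplat _ =>
    h p hp e he K s₀ hs W (hpos_of_plateau hA hp (one_le_two.trans he) hs W hplat h1)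

/-- Hence both halves are WEAKER than the blocker's class (modulo the PROVED no-jump law). [folklore] -/
theorem high_of_deep (hA : ShadeNeverIncreases) (h : DefectWalksTerminateDeep) : NoHighPlateauxDeep :=
  high_of_recSubcritical (recSubcritical_of_deep hA h)

/-- The jump half 31871's class from the no-jump law (by letter). [folklore] -/
theorem noRecurrentJump_of_never (hA : ShadeNeverIncreases) : NoRecurrentJumpWalksDeep := by
  intro p hp e he K _ _ _ _ s₀ hs W _ hR
  obtain ⟨t, -, hj⟩ := hR 0
  exact absurd (hA p hp e (one_le_two.trans he) K s₀ hs W t) (not_le.mpr hj)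

end Cut

/-! ## §6 WIRING: the ONE certified EQUIV and the asides 31870 / 31770, BY NAME -/

section Wiring

/-- **SUBCRITICALITY OF SATELLITE PLATEAUX (re-proved from the tree; lens-3 g13).**  A plateau of height `s` visited
by satellite moves at infinitely many times has `s < q`. [folklore] -/
theorem plateau_lt_of_satellite_io {p e : ℕ} {K : Type} [Field K] [DecidableEq K] {s₀ : State (Fin 3) K}
    (hroot : IsRoot (p ^ e) s₀) (W : ForcedWalk (p ^ e) s₀) {N s : ℕ}
    (hplat : ∀ t, N ≤ t → (W.st t).shade = (s : ℕ∞)) (hsat : ∀ M : ℕ, ∃ t, M ≤ t ∧ W.Satellite t) :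
    s < p ^ e := by
  classical
  have hsq : s ≤ p ^ e := by
    by_contra hlt
    rw [not_le] at hlt
    exact not_eventually_supercritical hroot W ⟨N, fun t ht => by
      rw [hplat t ht]
      exact_mod_cast hlt⟩
  rcases hsq.lt_or_eq with hlt | hsq'
  · exact hlt
  exfalso
  have hstep : ∀ t, N ≤ t → (W.st (t + 1)).r.degree = (kept W t).degree + (W.st t).r.degree := by
    intro t ht
    obtain ⟨s', hs', hled⟩ := ledger_step hroot W t
    have hss' : s' = s := by
      have h := hplat t ht
      rw [hs'] at h
      exact_mod_cast h
    rw [hss', hsq'] at hled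
    omega
  have hmono : ∀ t, N ≤ t → ∀ u, t ≤ u → (W.st t).r.degree ≤ (W.st u).r.degree := by
    intro t ht u hu
    induction u, hu using Nat.le_induction with
    | base => exact le_rfl
    | succ u hu ih =>
      rw [hstep u (ht.trans hu)]
      omega
  have hgrow : ∀ k : ℕ, ∃ t, N ≤ t ∧ k ≤ (W.st t).r.degree := by
    intro k
    induction k with
    | zero => exact ⟨N, le_rfl, Nat.zero_le _⟩
    | succ k ih =>
      obtain ⟨t, ht, hk⟩ := ih
      obtain ⟨u, hu, hsu⟩ := hsat t
      have hkept : (kept W u).degree ≠ 0 := by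
        rw [Ne, Finsupp.degree_eq_zero_iff]
        exact (satellite_iff_kept_ne_zero W u).mp hsu
      refine ⟨u + 1, by omega, ?_⟩
      rw [hstep u (ht.trans hu)]
      have := hmono t ht u hu
      omega
  obtain ⟨t, ht, hq⟩ := hgrow (p ^ e)
  obtain ⟨o, ho, -, ho2⟩ := NoJump.order_lt_two_mul hroot W t
  obtain ⟨s', hs', hos⟩ := order_eq_shade_add_degree hroot W t ho
  have hss' : s' = s := by
    have h := hplat t ht
    rw [hs'] at h
    exact_mod_cast h
  omega

/-- **THE PLATEAU HALF 31870's class from the pieces (PROVED wiring).**  A deep walk with positive, eventually constant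
shade sits on a plateau of height `s ∈ [1, q]` (`not_eventually_supercritical`); `s = q` ⇒ no satellite recurrence
(`plateau_lt_of_satellite_io`) ⇒ eventually free ⇒ the critical free plateau (`free_tail_rigid`), bare (`r = 0`,
floor: `hT`) or loaded (`hL`); `s < q` with finitely many translations ⇒ `hO`; else a floor time hands the tail to
`hT` (FLOOR ABSORPTION keeps `o = q` for ever) and no floor time hands it to THE residual `hH` (height `≥ 2` by
`high_iff_highTwo`). [folklore] -/
theorem noPlateauWalksDeep_of_pieces (hO : NoOriginTails) (hL : NoLoadedCriticalPlateauxDeep)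
    (hT : NoFloorTailsDeep) (hH : NoHighPlateauxDeepTwo) : NoPlateauWalksDeep := by
  intro p hp e he K _ _ _ _ s₀ hs W hpos hstall
  classical
  have hH' : NoHighPlateauxDeep := high_iff_highTwo.mpr hH
  obtain ⟨N, hN⟩ := hstall
  have hconst : ∀ t, N ≤ t → (W.st t).shade = (W.st N).shade := by
    intro t ht
    induction t, ht using Nat.le_induction with
    | base => rfl
    | succ t ht ih => exact (hN t ht).trans ih
  obtain ⟨o, ho, -⟩ := walk_nat hs W N
  obtain ⟨s, hsN, -⟩ := order_eq_shade_add_degree hs W N ho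
  have hplat : ∀ t, N ≤ t → (W.st t).shade = (s : ℕ∞) := fun t ht => (hconst t ht).trans hsN
  have h1 : 1 ≤ s := by
    have h := hpos N
    rw [hsN] at h
    exact_mod_cast h
  have hsq : s ≤ p ^ e := by
    by_contra hlt
    rw [not_le] at hlt
    exact not_eventually_supercritical hs W ⟨N, fun t ht => by
      rw [hplat t ht]
      exact_mod_cast hlt⟩
  rcases hsq.lt_or_eq with hlt | heq
  · -- subcritical plateau
    by_cases htr : ∀ M : ℕ, ∃ i, M ≤ i ∧ W.b i ≠ 0
    · by_cases hfloor : ∃ t₀, N ≤ t₀ ∧ ordZero (W.st t₀).F = ((p ^ e : ℕ) : ℕ∞)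
      · obtain ⟨t₀, ht₀, ho₀⟩ := hfloor
        exact hT p hp e he K s₀ hs W hpos t₀ fun t ht => (floor_absorbing hs W hplat ht₀ ho₀ t ht).1
      · push Not at hfloor
        refine hH' p hp e he K s₀ hs W N s h1 hlt (fun t ht => ⟨hplat t ht, ?_⟩) htr
        obtain ⟨o', ho', hqo'⟩ := walk_nat hs W t
        have hne : o' ≠ p ^ e := fun hoq => hfloor t ht (by rw [ho', hoq])
        rw [ho']
        exact_mod_cast lt_of_le_of_ne hqo' (Ne.symm hne)
    · push Not at htr
      obtain ⟨M, hM⟩ := htr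
      exact hO p hp e (one_le_two.trans he) K s₀ hs W M hM
  · -- critical plateau: eventually free, then bare (floor) or loaded
    have hfree : ∃ M, ∀ t, M ≤ t → ¬ W.Satellite t := by
      by_contra hcon
      push Not at hcon
      have := plateau_lt_of_satellite_io hs W hplat hcon
      omega
    obtain ⟨N₁, ρ, -, hrig⟩ := free_tail_rigid hp hs W hfree
    rcases Nat.eq_zero_or_pos ρ with hρ | hρ
    · refine hT p hp e he K s₀ hs W hpos N₁ fun t ht => ?_
      rw [(hrig t ht).2.2.2, hρ, add_zero]
    · exact hL p hp e he K s₀ hs W hpos N₁ ρ hρ fun t ht => ⟨(hrig t ht).1, (hrig t ht).2.1, (hrig t ht).2.2.1⟩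

/-- Necessity of the loaded cell from the plateau half (by letter: a loaded critical plateau is a plateau).
[folklore] -/
theorem loaded_of_noPlateau (h : NoPlateauWalksDeep) : NoLoadedCriticalPlateauxDeep := by
  intro p hp e he K _ _ _ _ s₀ hs W hpos N ρ _ hC
  refine h p hp e he K s₀ hs W hpos ⟨N, fun t ht => ?_⟩
  show (W.st (t + 1)).shade = (W.st t).shade
  rw [(hC (t + 1) (by omega)).2.1, (hC t ht).2.1]

/-- Necessity of the floor cell from the plateau half (by letter, through the blocker's class). [folklore] -/
theorem floorTails_of_noPlateau (h : NoPlateauWalksDeep) (hJ : NoRecurrentJumpWalksDeep) : NoFloorTailsDeep :=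
  floorTails_of_deep (deep_of_itinerary h hJ)

/-- **THE ONE CERTIFIED EQUIV (PROVED), modulo the two PROVED HOME theorems restated in §3 (no-jump law, origin
tails): `DefectWalksTerminateDeep ⟺ NoLoadedCriticalPlateauxDeep ∧ NoFloorTailsDeep ∧ NoHighPlateauxDeepTwo`** —
loaded critical cell (desk-decided, lens-3 g12) ∧ FLOOR cell (KNOWN-MOD-PORT `BareTailPort`) ∧ THE residual (high
subcritical plateaux at heights `2 … q−1` with translations i.o.). [folklore] -/
theorem defectDeep_iff_pieces (hA : ShadeNeverIncreases) (hO : NoOriginTails) :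
    DefectWalksTerminateDeep ↔ NoLoadedCriticalPlateauxDeep ∧ NoFloorTailsDeep ∧ NoHighPlateauxDeepTwo := by
  constructor
  · intro h
    exact ⟨loaded_of_noPlateau (noPlateau_of_deep h), floorTails_of_deep h,
      high_iff_highTwo.mp (high_of_deep hA h)⟩
  · rintro ⟨hL, hT, hH⟩
    exact deep_of_itinerary (noPlateauWalksDeep_of_pieces hO hL hT hH) (noRecurrentJump_of_never hA)

open Summit.ResolutionOfSingularities.ResolutionOfSingularities.Theses in
/-- **Aside 31870 `ICNoPlateauDeep` from the pieces, BY NAME.** [folklore] -/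
theorem icNoPlateauDeep_of_pieces (hO : NoOriginTails) (hL : NoLoadedCriticalPlateauxDeep)
    (hT : NoFloorTailsDeep) (hH : NoHighPlateauxDeepTwo) : MaxContactCut.ICNoPlateauDeep :=
  MaxContactCutItineraryCut.icNoPlateauDeep_iff.mpr (noPlateauWalksDeep_of_pieces hO hL hT hH)

open Summit.ResolutionOfSingularities.ResolutionOfSingularities.Theses in
/-- **Aside 31770 `DefectWalksDeep` from the pieces and the PROVED jump half 31871, BY NAME.**  Every hypothesis is
a tree item (`hJ` = 31871, PROVED in HOME by lens-5 g14 / lens-3 g13), a verbatim DECIDED HOME piece (`hO`, g12),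
the tree's loaded cell (`hL`, desk-decided g12), the FLOOR cell (`hT`, port) or THE residual (`hH`). [folklore] -/
theorem defectWalksDeep_of_pieces (hJ : MaxContactCut.ICNoRecurrentJumpDeep) (hO : NoOriginTails)
    (hL : NoLoadedCriticalPlateauxDeep) (hT : NoFloorTailsDeep) (hH : NoHighPlateauxDeepTwo) :
    MaxContactCut.DefectWalksDeep :=
  MaxContactCutItineraryCut.defectWalksDeep_of_ic (icNoPlateauDeep_of_pieces hO hL hT hH) hJ

open Summit.ResolutionOfSingularities.ResolutionOfSingularities.Theses in
/-- **Aside 31770 ⟺ THE residual, modulo the decided / ported pieces (PROVED glue, BY NAME).** [folklore] -/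
theorem defectWalksDeep_iff_high (hA : ShadeNeverIncreases) (hO : NoOriginTails) (hL : NoLoadedCriticalPlateauxDeep)
    (hT : NoFloorTailsDeep) : MaxContactCut.DefectWalksDeep ↔ NoHighPlateauxDeepTwo :=
  MaxContactCutTightDefect.defectWalksDeep_iff.trans
    ⟨fun h => ((defectDeep_iff_pieces hA hO).mp h).2.2, fun hH => (defectDeep_iff_pieces hA hO).mpr ⟨hL, hT, hH⟩⟩

end Wiring

/-! ## §6b DISCHARGE BY NAME (rev 1) — the tree's `Theorems/NoJump` (lens-5 g14, landed 2026-08-30T13:18Z; convergent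
with lens-3 g13 `JumpCut`) makes the no-jump hypothesis `hA` and the jump half `hJ` (item 31871) THEOREMS:
`NoJump.shade_succ_le_shade`, `NoJump.icNoRecurrentJumpDeep_holds`.  After this section the ONE EQUIV and the
BY-NAME up-link to 31770 are conditional on g12's origin-tail law `hO` ALONE (its E-model proof
`ProximityCut.noOriginTails_holds` is HOME, tree landing pending) plus the three pieces. -/

section Discharge

/-- **`ShadeNeverIncreases` HOLDS** — by name from the tree (`NoJump.shade_succ_le_shade`). [DECIDED · tree] [folklore] -/
theorem shadeNeverIncreases_holds : ShadeNeverIncreases :=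
  fun _ hp _ _ _ _ _ _ _ _ hs W t => NoJump.shade_succ_le_shade hp hs W t

/-- The floor half of the parent from the floor cell, unconditionally. [folklore] -/
theorem floorEdge_of_floorTails' (hT : NoFloorTailsDeep) : NoFloorEdgePlateauxDeep :=
  floorEdge_of_floorTails shadeNeverIncreases_holds hT

/-- The parent is WEAKER than the blocker's class by letter + the no-jump theorem. [folklore] -/
theorem recSubcritical_of_deep' (h : DefectWalksTerminateDeep) : NoRecurrentSubcriticalPlateauxDeep :=
  recSubcritical_of_deep shadeNeverIncreases_holds h

/-- THE residual is WEAKER than the blocker's class by letter + the no-jump theorem. [folklore] -/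
theorem highTwo_of_deep (h : DefectWalksTerminateDeep) : NoHighPlateauxDeepTwo :=
  high_iff_highTwo.mp (high_of_deep shadeNeverIncreases_holds h)

/-- **THE ONE CERTIFIED EQUIV, rev 1: modulo g12's origin-tail law only.** [folklore] -/
theorem defectDeep_iff_pieces' (hO : NoOriginTails) :
    DefectWalksTerminateDeep ↔ NoLoadedCriticalPlateauxDeep ∧ NoFloorTailsDeep ∧ NoHighPlateauxDeepTwo :=
  defectDeep_iff_pieces shadeNeverIncreases_holds hO

open Summit.ResolutionOfSingularities.ResolutionOfSingularities.Theses in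
/-- **Aside 31770 `DefectWalksDeep` from the pieces, 31871 discharged BY NAME** (`NoJump.icNoRecurrentJumpDeep_holds`).
[folklore] -/
theorem defectWalksDeep_of_pieces' (hO : NoOriginTails) (hL : NoLoadedCriticalPlateauxDeep)
    (hT : NoFloorTailsDeep) (hH : NoHighPlateauxDeepTwo) : MaxContactCut.DefectWalksDeep :=
  defectWalksDeep_of_pieces NoJump.icNoRecurrentJumpDeep_holds hO hL hT hH

open Summit.ResolutionOfSingularities.ResolutionOfSingularities.Theses in
/-- **Aside 31770 ⟺ THE residual modulo the decided / ported pieces, rev 1 (no-jump discharged).** [folklore] -/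
theorem defectWalksDeep_iff_high' (hO : NoOriginTails) (hL : NoLoadedCriticalPlateauxDeep) (hT : NoFloorTailsDeep) :
    MaxContactCut.DefectWalksDeep ↔ NoHighPlateauxDeepTwo :=
  defectWalksDeep_iff_high shadeNeverIncreases_holds hO hL hT

open Summit.ResolutionOfSingularities.ResolutionOfSingularities.Theses in
/-- **Aside 31770 ⟹ THE residual, unconditionally, BY NAME.** [folklore] -/
theorem highTwo_of_defectWalksDeep (h : MaxContactCut.DefectWalksDeep) : NoHighPlateauxDeepTwo :=
  highTwo_of_deep (MaxContactCutTightDefect.defectWalksDeep_iff.mp h)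

end Discharge

end Summit.ResolutionOfSingularities.ResolutionOfSingularities.Theorems.FloorCut
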